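import Summits.QuantumFields.YangMills.Theorems.UnitScaleTiltHalvingP1FlatCoreSupplierTopKnit
import Summits.QuantumFields.YangMills.Theorems.UnitScaleTiltHalvingP1FlatCoreSupplierGaugeDescent
import Summits.QuantumFields.YangMills.Theorems.UnitScaleTiltHalvingP1FlatCoreSupplierFramesSU2
import HarnessLib

/-!
# `hP1room` PROGRAMME (LEAD-H «H = hSupU» BOARD v2), (A-1) STAGE 3d FILE 2: ★★★ THE PER-SITE ASSEMBLY AT THE ROW LEVEL — the FamilyDoor's ∃-block from Theorem 4's
# datum, the COMPOSITE torus gauge, the top-step call's OUTPUT rows and the two remaining displayed rows ([R-h] sizes, [R-f]-traceless)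

Route `UnitScaleTilt`, crux K1 child «MinimiserStabilityRegPr» (stmt-QuantumFields-19200), registered stub `stub_halvingStep` (`BirthV10`), text `hP1room ⟸ hSupU`
(✓p641613 ∘ ✓p640588; per site ✓p643656 `HalvingP1FlatCoreSupplierDoor.hSup_of_contentRows` over nine content rows).  Cell `ym3-torus` (HUMAN RULING D-0037: YM₃ on T³ is ladder rung
R3 — NOT d = 4, NOT a mass gap, NOT the Clay problem), width seat `ym-ust-20520-w3` gen 6.  `--supports stmt-QuantumFields-19200 --as helper`; THEOREMS ONLY (0 `def`, 0 `sorry`);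
count-neutral; nothing here claims `core′`, `hP1room`, `hSupU`, the stub, the crux or the gap.

WHAT.  ★★★ `hSupBlock_of_topRows` — at one member∕site `(F, n < K, x₀)` with the route cube data `(ρ, S, M)` and N05's window letters `(a, M′, ρ′)` (`h0 h1 ha hroomW`), `k := K − n`:
GIVEN J3's pre-gauge `gJ` (SU(2)-valued torus gauge), Theorem 4's datum `(u₁, W, A)` at level `k − 1` in N05's letters (`hW : mgauge 1 u₁ W = pull (U^{gJ})♯ 0`, `u₁` special-unitary
— the τ-thread's displayed sibling —, the chart clause on the sides touching `□₀` and the chart-with-size clause on the top cube `□_k`), F3's effective-gauge tower `κf` of the charted iterate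
`W₁ := (U♯)^g` for the COMPOSITE gauge `g := (u₁ ∘ rep)⁻¹ · (toUnits ∘ suIncl ∘ gJ)` (`rep s := lift x₀ + rel x₀ s`), the top-step call's OUTPUT rows for its `λ′` (✓p646092
`HalvingP1FlatCoreSupplierTopCall.topRows_of_datum`, conjuncts 1, 2, 3 at `j = 0`, 4, 6, 7 — passed as rows so that the τ-sibling ∕ the Theorem-4 junction call plug in unchanged) PLUS
`λ′` traceless ([R-f]-tr, the τ-thread) and the two (1.36) size rows of `X₀ := logCfg η W^λ` ([R-h], ✓p644380∕p644717∕p645427's caller), and the numeric windows:  THE TWELVE-ROW ∃-BLOCK OF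
✓p640588 `HalvingP1FlatCoreFamilyDoor.p1FlatPillar'_room_of_suppliers`'s `hSup` AT THIS SITE (corner `a`).  MECHANISM (all by name): the towers `ν`, `gs′` (✓p641699 (T1)(T2)); [R-a] `hAchart` and
[R-c] `hg` (✓p645686 `hAchart_of_sideTouches`, `hg_of_datum` — the composite gauge's window-local identities); [R-g] `hCsu` (✓p644184 `hCsu_of_near_eta` ∘ ✓p645686 `hW1near_of_datum`);
[R-b][R-d][R-e][R-f]-sa (✓p646003 `doorRows_of_topRows`); then ✓p643656.  HONEST SCOPE: assembly; every analytic row stays DISPLAYED upstream (FILE B's N05 sockets∕letters∕datum, the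
torus blocks (D)(E), [R-h]'s Prop-3 sockets, the τ-thread); nothing of Prop. 5, Theorem 4, `core′` or the stub is proved here.

References: T. Bałaban, CMP **99** (1985) 75–102 [Balaban1985RegularSpaces] (Thm 2 p.83, (1.36)–(1.38) p.82, Prop. 5 (1.107)–(1.109) p.94, (1.131) p.99); CMP **98** (1985) 17–51
[Balaban1985Averaging] ((8) p.19, (55)–(57) p.27, (110) p.34); CMP **102** (1985) 277–309 [Balaban1985Variational] ((150)–(156) pp.301–302).
-/

set_option autoImplicit false

noncomputable section

open scoped BigOperators Matrix.Norms.L2Operator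
open NormedSpace
open Complex (I)

namespace Summit.QuantumFields.YangMills.Theorems.HalvingP1FlatCoreSupplierAssembly

open Literature.MathematicalPhysics.QuantumFieldTheory.Balaban1983to89
open Literature.MathematicalPhysics.QuantumFieldTheory.Balaban1983to89.T3ContinuumYM3Torus
open MatrixLog (mlog)
open B5Eq118OneStroke (iterBlockOf)
open B6SectAOperatorsV1 (SiteIdx)
open B7Prop1Explicit renaming Site → LSite
open B7Prop1Explicit (e)
open B7Prop2Explicit (unitaryUnits)
open B7Eq78Linearization (conjR)
open B7Eq92Concrete (mgauge)
open B8Ineq132 (covDerivFwd)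
open B8Eq131Cubes (cube gs cube_anti)
open B8Eq131CubesAdmissible (cubeFam cubeFam_false_of_le)
open B8Eq138LandauZd (covDivB covLap QT IsLandau138W logCfg)
open B8Eq140Level (SideTouches)
open B8Eq182Proof (gAd)
open B8Eq184Proof (gaugeExp cfgExp)
open B8Eq188Proof (frakF3)
open B8LambdaSpaceKLevel (wt)
open B8CubeMemberZd (cubeLamS)
open B8Prop5SocketDatum (sideTouches_pair_of_mem)
open B10Eq27TorusAxialLog (transl rel pull unitsField toUField suIncl gaugeActT axialT)
open B15Eq112TorusCover (lift)
open Node00 (coverAt)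
open LatticeFieldCalculus (laplace diverg siteAvgIter)
open FlatCubeOpsText (IsLevWeight)
open FlatCubeSequenceAligned (cubeSeqMT3 cubeSetM)
open Summit.QuantumFields.YangMills.Theorems.Prop8ChartDoubleBar (dbarIterU vframeU)
open HalvingP1FlatPillar (DP1Clause)
open HalvingP1FlatCoreSupplierTowers (exists_nuTower exists_gsTower)
open HalvingP1FlatCoreSupplierGaugeDescent (hAchart_of_sideTouches hg_of_datum hW1near_of_datum)
open HalvingP1FlatCoreSupplierFramesSU2 (hCsu_of_near_eta)
open HalvingP1FlatCoreSupplierTopKnit (doorRows_of_topRows)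
open HalvingP1FlatCoreSupplierDoor (hSup_of_contentRows)

variable {F : T3Family} {n K : ℕ}

open Classical in
/-- ★★★ **THE PER-SITE ASSEMBLY AT THE ROW LEVEL.**  See the module docstring: from J3's pre-gauge `gJ`, Theorem 4's datum `(u₁, W, A)` (N05's letters, `u₁` special-unitary),
F3's tower `κf` of `W₁ := (U♯)^g` for the composite `g`, the top-step call's output rows for `λ′` (✓p646092's conjuncts, as rows) + `λ′` traceless + the two size rows of
`X₀ := logCfg η W^λ`, and the windows — the FamilyDoor's twelve-row ∃-block at this site.
[cite: Balaban1985RegularSpaces, Thm 2 p.83, (1.36)-(1.38) p.82, (1.107)-(1.109) p.94, (1.131) p.99; Balaban1985Averaging, (8) p.19, (55)-(57) p.27, (110) p.34; Balaban1985Variational, (150)-(156) pp.301-302] -/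
theorem hSupBlock_of_topRows (hd2 : 2 ≤ (F.P K).d) (hnK : n < K) (x₀ : Site (F.P K) 0) (ρ S M : ℕ) (hM : 1 ≤ M) (hS : 2 ≤ S)
    {a : LSite (F.P K).d} {M' ρ' : ℕ} (h0 : ρ + M ≤ ρ' + 1) (h1 : (F.P K).L + S + M ≤ ρ' + 2)
    (ha : ∀ ν, a ν ≤ ((iterBlockOf (K - n) x₀ ν).val : ℤ) ∧ ((iterBlockOf (K - n) x₀ ν).val : ℤ) ≤ a ν + M' - 1)
    (hroomW : 2 * ((F.P K).L ^ (K - n) * (M' + 1) + ρ' * gs (F.P K).L (K - n)) ≤ (F.P K).sitesPerDir 0)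
    (U : GaugeField (F.P K) 0 (Matrix.specialUnitaryGroup (Fin 2) ℂ)) {ε₀ B₁ : ℝ} (hε₀ : 0 < ε₀) (hB₁ : 0 ≤ B₁)
    -- J3's pre-gauge and Theorem 4's datum at level `k − 1` (N05's letters; `u₁` special-unitary = the τ-thread's displayed sibling)
    (gJ : GaugeTransf (F.P K) 0 (Matrix.specialUnitaryGroup (Fin 2) ℂ))
    (u₁ : LSite (F.P K).d → (Matrix (Fin 2) (Fin 2) ℂ)ˣ) (W : LSite (F.P K).d → Fin (F.P K).d → (Matrix (Fin 2) (Fin 2) ℂ)ˣ)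
    (A : LSite (F.P K).d → Fin (F.P K).d → Matrix (Fin 2) (Fin 2) ℂ)
    (hu₁SU : ∀ z, ((u₁ z : (Matrix (Fin 2) (Fin 2) ℂ)ˣ) : Matrix (Fin 2) (Fin 2) ℂ) ∈ Matrix.specialUnitaryGroup (Fin 2) ℂ)
    (hW : mgauge (1 : LSite (F.P K).d → Fin (F.P K).d → (Matrix (Fin 2) (Fin 2) ℂ)ˣ) u₁ W = pull (unitsField (toUField (GaugeField.gaugeAct gJ U))) 0)
    (hchart₀ : ∀ b ∈ {b : LSite (F.P K).d × Fin (F.P K).d | SideTouches (cubeFam false (F.P K).L a M' ρ' (K - n) 0) b.1 b.2},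
      W b.1 b.2 = cfgExp (((F.L : ℝ)⁻¹) ^ (K - n)) A b.1 b.2)
    {c₁ c' : ℝ} (hc' : 0 ≤ c') (hbudget : 8 * 3800 * ((((F.P K).d + 2) * (F.P K).L : ℕ) : ℝ) ^ 2 * c' ≤ 1)
    (hc₁ : Real.exp c₁ - 1 ≤ ((F.L : ℝ)⁻¹) ^ (K - n) * c')
    (hchartTop : ∀ z ∈ cube (F.P K).L a M' ρ' (K - n) (K - n), ∀ ν : Fin (F.P K).d,
      W z ν = cfgExp (((F.L : ℝ)⁻¹) ^ (K - n)) A z ν ∧ ((F.L : ℝ)⁻¹) ^ (K - n) * ‖A z ν‖ ≤ c₁)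
    -- F3's effective-gauge tower of the charted iterate `W₁ := (U♯)^g`, composite `g`
    (κf : (Site (F.P K) 0 → Matrix (Fin 2) (Fin 2) ℂ) → (i : ℕ) → GaugeTransf (F.P K) i (Matrix (Fin 2) (Fin 2) ℂ)ˣ)
    (hκfs : ∀ (m : Site (F.P K) 0 → Matrix (Fin 2) (Fin 2) ℂ) (i : ℕ) (y : Site (F.P K) (i + 1)),
      κf m (i + 1) y = (vframeU (gaugeActT (κf m i) (dbarIterU i (gaugeActT
        (fun s => (u₁ (lift (F.P K) x₀ + rel x₀ s))⁻¹ * Unitary.toUnits (suIncl (gJ s)) : GaugeTransf (F.P K) 0 (Matrix (Fin 2) (Fin 2) ℂ)ˣ)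
        (unitsField (toUField U))))) y)⁻¹ * κf m i (emb y) *
        vframeU (dbarIterU i (gaugeActT
          (fun s => (u₁ (lift (F.P K) x₀ + rel x₀ s))⁻¹ * Unitary.toUnits (suIncl (gJ s)) : GaugeTransf (F.P K) 0 (Matrix (Fin 2) (Fin 2) ℂ)ˣ)
          (unitsField (toUField U)))) y)
    (hκf0 : ∀ (m : Site (F.P K) 0 → Matrix (Fin 2) (Fin 2) ℂ) (x : Site (F.P K) 0), ((κf m 0 x : (Matrix (Fin 2) (Fin 2) ℂ)ˣ) : Matrix (Fin 2) (Fin 2) ℂ) = exp (m x))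
    -- the top-step call's OUTPUT rows for `λ′` (✓`HalvingP1FlatCoreSupplierTopCall.topRows_of_datum`'s conjuncts 1, 2, 3 at `j = 0`, 4, 6, 7) + `λ′` traceless (τ-thread)
    {lam : LSite (F.P K).d → Matrix (Fin 2) (Fin 2) ℂ} {α₄ cA : ℝ}
    (hα0 : 0 ≤ α₄) (hα : α₄ ≤ 1 / 70) (hcA0 : 0 ≤ cA) (hcA : cA ≤ 1 / 12)
    (hsa : ∀ x, IsSelfAdjoint (lam x)) (htr : ∀ x, (lam x).trace = 0)
    (hsupp : ∀ x, x ∉ cubeFam false (F.P K).L a M' ρ' (K - n) 0 → lam x = 0)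
    (h108₀ : ∀ b ∈ {b : LSite (F.P K).d × Fin (F.P K).d | SideTouches (cubeFam false (F.P K).L a M' ρ' (K - n) 0) b.1 b.2},
      ‖lam b.1‖ ≤ α₄ ∧ wt (F.P K).L (((F.L : ℝ)⁻¹) ^ (K - n)) 0 *
        ‖covDerivFwd (((F.L : ℝ)⁻¹) ^ (K - n)) (1 : LSite (F.P K).d → Fin (F.P K).d → (Matrix (Fin 2) (Fin 2) ℂ)ˣ) b.2 lam b.1‖ ≤ α₄)
    (hmult : ∃ μ : ℕ → LSite (F.P K).d → Matrix (Fin 2) (Fin 2) ℂ, ∀ x ∈ cubeFam false (F.P K).L a M' ρ' (K - n) 0,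
      covLap (((F.L : ℝ)⁻¹) ^ (K - n)) (1 : LSite (F.P K).d → Fin (F.P K).d → (Matrix (Fin 2) (Fin 2) ℂ)ˣ)
        ((cubeFam false (F.P K).L a M' ρ' (K - n) 0).indicator fun y =>
          covDivB (((F.L : ℝ)⁻¹) ^ (K - n)) (1 : LSite (F.P K).d → Fin (F.P K).d → (Matrix (Fin 2) (Fin 2) ℂ)ˣ) A y +
          covLap (((F.L : ℝ)⁻¹) ^ (K - n)) (1 : LSite (F.P K).d → Fin (F.P K).d → (Matrix (Fin 2) (Fin 2) ℂ)ˣ) lam y +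
          ((conjR (gaugeExp lam y)⁻¹ (covDivB (((F.L : ℝ)⁻¹) ^ (K - n)) (1 : LSite (F.P K).d → Fin (F.P K).d → (Matrix (Fin 2) (Fin 2) ℂ)ˣ) A y) -
              covDivB (((F.L : ℝ)⁻¹) ^ (K - n)) (1 : LSite (F.P K).d → Fin (F.P K).d → (Matrix (Fin 2) (Fin 2) ℂ)ˣ) A y) +
            (gAd (covLap (((F.L : ℝ)⁻¹) ^ (K - n)) (1 : LSite (F.P K).d → Fin (F.P K).d → (Matrix (Fin 2) (Fin 2) ℂ)ˣ) lam y) (lam y) -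
              covLap (((F.L : ℝ)⁻¹) ^ (K - n)) (1 : LSite (F.P K).d → Fin (F.P K).d → (Matrix (Fin 2) (Fin 2) ℂ)ˣ) lam y) +
            ∑ μ, frakF3 (((F.L : ℝ)⁻¹) ^ (K - n)) (1 : LSite (F.P K).d → Fin (F.P K).d → (Matrix (Fin 2) (Fin 2) ℂ)ˣ) lam A y μ)) x =
        QT (F.P K).L (K - n) (cubeLamS (F.P K).L a M' ρ' (K - n) (K - n)) (1 : LSite (F.P K).d → Fin (F.P K).d → (Matrix (Fin 2) (Fin 2) ℂ)ˣ) μ x)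
    (htopId : ∀ yc ∈ cubeLamS (F.P K).L a M' ρ' (K - n) (K - n) (K - n),
      κf (((-I) • lam) ∘ fun s : Site (F.P K) 0 => lift (F.P K) x₀ + rel x₀ s) (K - n) (coverAt (F.P K) (K - n) yc) =
        axialT (dbarIterU (K - n) (gaugeActT
          (fun s => (u₁ (lift (F.P K) x₀ + rel x₀ s))⁻¹ * Unitary.toUnits (suIncl (gJ s)) : GaugeTransf (F.P K) 0 (Matrix (Fin 2) (Fin 2) ℂ)ˣ)
          (unitsField (toUField U)))) (iterBlockOf (K - n) x₀) (coverAt (F.P K) (K - n) yc))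
    (hA0 : ∀ x ∈ cubeFam false (F.P K).L a M' ρ' (K - n) 0, ∀ μ : Fin (F.P K).d,
      wt (F.P K).L (((F.L : ℝ)⁻¹) ^ (K - n)) 0 * ‖A x μ‖ ≤ cA ∧
        wt (F.P K).L (((F.L : ℝ)⁻¹) ^ (K - n)) 0 *
          ‖conjR ((1 : LSite (F.P K).d → Fin (F.P K).d → (Matrix (Fin 2) (Fin 2) ℂ)ˣ) (x - e μ) μ)⁻¹ (A (x - e μ) μ)‖ ≤ cA)
    -- [R-h] the two (1.36) size rows of `X₀ := logCfg η W^λ` on N05's level cubes (✓p644380∕p644717's caller supplies them)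
    (hX1 : ∀ j, j ≤ K - n → ∀ z ∈ cube (F.P K).L a M' ρ' (K - n) j, ∀ ν' : Fin (F.P K).d,
      (F.L : ℝ) ^ j * ((F.L : ℝ)⁻¹) ^ (K - n) *
        ‖logCfg (((F.L : ℝ)⁻¹) ^ (K - n)) (mgauge (1 : LSite (F.P K).d → Fin (F.P K).d → (Matrix (Fin 2) (Fin 2) ℂ)ˣ) (gaugeExp lam)⁻¹
          (cfgExp (((F.L : ℝ)⁻¹) ^ (K - n)) A)) z ν'‖ ≤ B₁ * ε₀)
    (hX2 : ∀ j, j ≤ K - n → ∀ z ∈ cube (F.P K).L a M' ρ' (K - n) j, ∀ ν' μ' : Fin (F.P K).d,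
      z + e μ' ∈ cube (F.P K).L a M' ρ' (K - n) 0 →
      ((F.L : ℝ) ^ j * ((F.L : ℝ)⁻¹) ^ (K - n)) ^ 2 * (F.L : ℝ) ^ (K - n) *
        ‖logCfg (((F.L : ℝ)⁻¹) ^ (K - n)) (mgauge (1 : LSite (F.P K).d → Fin (F.P K).d → (Matrix (Fin 2) (Fin 2) ℂ)ˣ) (gaugeExp lam)⁻¹
            (cfgExp (((F.L : ℝ)⁻¹) ^ (K - n)) A)) (z + e μ') ν' -
          logCfg (((F.L : ℝ)⁻¹) ^ (K - n)) (mgauge (1 : LSite (F.P K).d → Fin (F.P K).d → (Matrix (Fin 2) (Fin 2) ℂ)ˣ) (gaugeExp lam)⁻¹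
            (cfgExp (((F.L : ℝ)⁻¹) ^ (K - n)) A)) z ν'‖ ≤ B₁ * ε₀) :
    ∃ (w : LSite (F.P K).d → Matrix.specialUnitaryGroup (Fin 2) ℂ) (X : LSite (F.P K).d → Fin (F.P K).d → Matrix (Fin 2) (Fin 2) ℂ)
      (μ : ℕ → LSite (F.P K).d → Matrix (Fin 2) (Fin 2) ℂ)
      (g h' : GaugeTransf (F.P K) 0 (Matrix (Fin 2) (Fin 2) ℂ)ˣ) (κ' : (i : ℕ) → GaugeTransf (F.P K) i (Matrix (Fin 2) (Fin 2) ℂ)ˣ)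
      (ν : (i : ℕ) → Site (F.P K) i → (Matrix (Fin 2) (Fin 2) ℂ)ˣ) (gs' : (i : ℕ) → GaugeTransf (F.P K) i (Matrix (Fin 2) (Fin 2) ℂ)ˣ),
      (∀ z ∈ cube (F.P K).L a M' ρ' (K - n) 0, ∀ ν : Fin (F.P K).d,
        transl (0 : Site (F.P K) 0) z ∈ cubeSetM x₀ (K - n) ρ S M 0 → (transl (0 : Site (F.P K) 0) z).shift ν ∈ cubeSetM x₀ (K - n) ρ S M 0 →
        ‖(((Unitary.toUnits (suIncl (w z)))⁻¹ * unitsField (toUField U) ⟨transl 0 z, ν⟩ * Unitary.toUnits (suIncl (w (z + e ν))) :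
            (Matrix (Fin 2) (Fin 2) ℂ)ˣ) : Matrix (Fin 2) (Fin 2) ℂ) - 1‖ ≤ 1 / 4) ∧
      (∀ z ∈ cube (F.P K).L a M' ρ' (K - n) 0, ∀ ν : Fin (F.P K).d,
        transl (0 : Site (F.P K) 0) z ∈ cubeSetM x₀ (K - n) ρ S M 0 → (transl (0 : Site (F.P K) 0) z).shift ν ∈ cubeSetM x₀ (K - n) ρ S M 0 →
        I • ((((F.L : ℝ)⁻¹) ^ (K - n)) • X z ν) = mlog (((Unitary.toUnits (suIncl (w z)))⁻¹ * unitsField (toUField U) ⟨transl 0 z, ν⟩ *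
            Unitary.toUnits (suIncl (w (z + e ν))) : (Matrix (Fin 2) (Fin 2) ℂ)ˣ) : Matrix (Fin 2) (Fin 2) ℂ)) ∧
      (∀ z ∈ cube (F.P K).L a M' ρ' (K - n) 0,
        covLap (((F.L : ℝ)⁻¹) ^ (K - n)) (1 : LSite (F.P K).d → Fin (F.P K).d → (Matrix (Fin 2) (Fin 2) ℂ)ˣ)
            ((cube (F.P K).L a M' ρ' (K - n) 0).indicator
              (covDivB (((F.L : ℝ)⁻¹) ^ (K - n)) (1 : LSite (F.P K).d → Fin (F.P K).d → (Matrix (Fin 2) (Fin 2) ℂ)ˣ) X)) z =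
          QT (F.P K).L (K - n) (cubeLamS (F.P K).L a M' ρ' (K - n) (K - n))
            (1 : LSite (F.P K).d → Fin (F.P K).d → (Matrix (Fin 2) (Fin 2) ℂ)ˣ) μ z) ∧
      κ' 0 = h' ∧
      (∀ (i : ℕ) (y : Site (F.P K) (i + 1)),
        κ' (i + 1) y = (vframeU (gaugeActT (κ' i) (dbarIterU i (gaugeActT g (unitsField (toUField U))))) y)⁻¹ * κ' i (emb y) *
          vframeU (dbarIterU i (gaugeActT g (unitsField (toUField U)))) y) ∧
      (∀ s, ν 0 s = 1) ∧
      (∀ (i : ℕ) (y : Site (F.P K) (i + 1)), ν (i + 1) y = ν i (emb y) * vframeU (dbarIterU i (gaugeActT g (unitsField (toUField U)))) y) ∧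
      gs' 0 = g ∧ (∀ (i : ℕ) (y : Site (F.P K) (i + 1)), gs' (i + 1) y = gs' i (emb y)) ∧
      (∀ s, (Unitary.toUnits (suIncl (w (lift (F.P K) x₀ + rel x₀ s))))⁻¹ =
        ((gs' (K - n) (iterBlockOf (K - n) x₀))⁻¹ * ν (K - n) (iterBlockOf (K - n) x₀)) * h' s * g s) ∧
      (∀ yc ∈ cubeLamS (F.P K).L a M' ρ' (K - n) (K - n) (K - n),
        κ' (K - n) (coverAt (F.P K) (K - n) yc) =
          axialT (dbarIterU (K - n) (gaugeActT g (unitsField (toUField U)))) (iterBlockOf (K - n) x₀) (coverAt (F.P K) (K - n) yc)) ∧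
      (∀ wt : ℕ → PBond (F.P K) 0 → ℝ, IsLevWeight F n K (cubeSeqMT3 F n K x₀ ρ S M hM) wt →
        (∀ b : PBond (F.P K) 0, wt 1 b *
          ‖(fun b : PBond (F.P K) 0 => if b.src ∈ cubeSetM x₀ (K - n) ρ S M 0 ∧ b.tgt ∈ cubeSetM x₀ (K - n) ρ S M 0 then
            X (lift (F.P K) x₀ + rel x₀ b.src) b.dir else 0) b‖ ≤ B₁ * ε₀) ∧
        (∀ (b : PBond (F.P K) 0) (ν' : Fin (F.P K).d), wt 2 b * (F.L : ℝ) ^ (K - n) *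
          ‖(fun b : PBond (F.P K) 0 => if b.src ∈ cubeSetM x₀ (K - n) ρ S M 0 ∧ b.tgt ∈ cubeSetM x₀ (K - n) ρ S M 0 then
              X (lift (F.P K) x₀ + rel x₀ b.src) b.dir else 0) ⟨b.src.shift ν', b.dir⟩ -
            (fun b : PBond (F.P K) 0 => if b.src ∈ cubeSetM x₀ (K - n) ρ S M 0 ∧ b.tgt ∈ cubeSetM x₀ (K - n) ρ S M 0 then
              X (lift (F.P K) x₀ + rel x₀ b.src) b.dir else 0) b‖ ≤ B₁ * ε₀)) := by
  have hL0 : (0 : ℝ) < F.L := by exact_mod_cast (F.P K).L_pos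
  have hη0 : (0 : ℝ) ≤ ((F.L : ℝ)⁻¹) ^ (K - n) := by positivity
  -- the composite torus gauge and its charted iterate
  let g : GaugeTransf (F.P K) 0 (Matrix (Fin 2) (Fin 2) ℂ)ˣ := fun s => (u₁ (lift (F.P K) x₀ + rel x₀ s))⁻¹ * Unitary.toUnits (suIncl (gJ s))
  -- the accumulated frames and the pulled-back pre-gauge ((T1)(T2))
  obtain ⟨ν, hν0, hνs⟩ := exists_nuTower (gaugeActT g (unitsField (toUField U)))
  obtain ⟨gs', hg0, hgs⟩ := exists_gsTower g
  -- [R-c] the composite gauge is special unitary; [R-a] the chart identity on the window bonds (✓p645686)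
  have hg : ∀ s : Site (F.P K) 0, ((g s : (Matrix (Fin 2) (Fin 2) ℂ)ˣ) : Matrix (Fin 2) (Fin 2) ℂ) ∈ Matrix.specialUnitaryGroup (Fin 2) ℂ :=
    hg_of_datum x₀ gJ u₁ hu₁SU
  have hΩ₀ : cube (F.P K).L a M' ρ' (K - n) 0 ⊆ cubeFam false (F.P K).L a M' ρ' (K - n) 0 := by
    rw [cubeFam_false_of_le _ _ _ _ (Nat.zero_le _)]
  have hAchart := hAchart_of_sideTouches x₀ ρ S M hM h0 h1 ha hroomW U gJ u₁ W hW hΩ₀ (Q := fun _ => True)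
    (fun b hb => ⟨hchart₀ b hb, trivial⟩)
  -- [R-g] the frame constant is special unitary (✓p644184 ∘ ✓p645686)
  have hW1near := hW1near_of_datum x₀ ρ S M hM h0 h1 ha hroomW U gJ u₁ W hW hη0 hchartTop
  have hCsu := hCsu_of_near_eta x₀ U g hg ν hν0 hνs gs' hg0 hgs hc' hbudget
    (fun b hs ht => (hW1near b hs ht).trans hc₁)
  -- [R-b][R-d][R-e][R-f]-sa from the top-step call's output rows (✓p646003)
  obtain ⟨hnear, hLanW, htop, _⟩ := doorRows_of_topRows hd2 x₀ ρ S M U g κf hα0 hα hcA0 hcA hsa hsupp h108₀ hmult htopId hA0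
  -- the door (✓p643656)
  exact hSup_of_contentRows hnK x₀ ρ S M hM hS h0 h1 ha hroomW U hε₀ hB₁ g κf hκfs hκf0 ν hν0 hνs gs' hg0 hgs A lam hAchart hnear hLanW htop
    hCsu (fun z => ⟨hsa z, htr z⟩) hg hX1 hX2


/-! ## §2 (v1.1) Two glue rows for the outer knit: `hchartTop` from Theorem 4's `hdat`, and the `hc₁` arithmetic -/

section Glue

variable {d : ℕ} {𝔸 : Type*} [NormedRing 𝔸] [NormedAlgebra ℂ 𝔸] [CompleteSpace 𝔸] [StarRing 𝔸]

/-- ★ `hchartTop` of `hSupBlock_of_topRows` FROM THEOREM 4's DATUM ROW `hdat` (✓p646092's letter, member `Ω j := cubeFam false L a M′ ρ′ (m+1) j`) read at the deepest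
datum level `j = m` on the top cube `□_{m+1} ⊆ □_m = Ω_m` (sides by ✓`sideTouches_pair_of_mem`): `W = e^{iηA}` and `η‖A‖ ≤ c⋆·L^{−m}` there (`c₁ := c⋆·L^{−m}`).
[cite: Balaban1985RegularSpaces, (1.68)-(1.69) p.88, (1.131) p.99] -/
theorem hchartTop_of_hdat (hd2 : 2 ≤ d) {L : ℕ} (a : LSite d) (M' ρ' m : ℕ) {η cs : ℝ} (hη : 0 < η)
    {W : LSite d → Fin d → 𝔸ˣ} {A : LSite d → Fin d → 𝔸}
    (hdat : ∀ j, j ≤ m → ∀ b ∈ {b : LSite d × Fin d | SideTouches (cubeFam false L a M' ρ' (m + 1) j) b.1 b.2},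
      W b.1 b.2 = cfgExp η A b.1 b.2 ∧ IsSelfAdjoint (A b.1 b.2) ∧ ‖A b.1 b.2‖ ≤ cs * ((L : ℝ) ^ j * η)⁻¹) :
    ∀ z ∈ cube L a M' ρ' (m + 1) (m + 1), ∀ ν : Fin d, W z ν = cfgExp η A z ν ∧ η * ‖A z ν‖ ≤ cs * ((L : ℝ) ^ m)⁻¹ := by
  intro z hz ν
  have hzm : z ∈ cubeFam false L a M' ρ' (m + 1) m := by
    rw [cubeFam_false_of_le _ _ _ _ (Nat.le_succ m)]
    exact cube_anti (Nat.le_succ m) le_rfl hz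
  obtain ⟨hW, -, hA⟩ := hdat m le_rfl (z, ν) (sideTouches_pair_of_mem hd2 hzm ν).1
  refine ⟨hW, ?_⟩
  calc η * ‖A z ν‖ ≤ η * (cs * ((L : ℝ) ^ m * η)⁻¹) := mul_le_mul_of_nonneg_left hA hη.le
    _ = cs * ((L : ℝ) ^ m)⁻¹ := by rw [mul_inv, mul_left_comm η, mul_left_comm η, mul_inv_cancel₀ hη.ne', mul_one]

end Glue

/-- ★ THE `hc₁` ARITHMETIC of `hSupBlock_of_topRows`: for `c₁ := c⋆·L^{−m} ≤ 1`, `e^{c₁} − 1 ≤ η·(2·L·c⋆)` at `η = L^{−(m+1)}` (`e^x − 1 ≤ 2x` on `[0, 1]`); so the assembly's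
`c' := 2·L·c⋆` and its one window reads `8·3800((d+2)L)²·(2·L·c⋆) ≤ 1`. [cite: Balaban1985RegularSpaces, (1.131) p.99] -/
theorem hc₁_of_small {L : ℕ} (hL : 1 ≤ L) (m : ℕ) {cs : ℝ} (hcs : 0 ≤ cs) (h : cs * ((L : ℝ) ^ m)⁻¹ ≤ 1) :
    Real.exp (cs * ((L : ℝ) ^ m)⁻¹) - 1 ≤ ((L : ℝ)⁻¹) ^ (m + 1) * (2 * L * cs) := by
  have hL0 : (0 : ℝ) < L := by exact_mod_cast hL
  have hx0 : 0 ≤ cs * ((L : ℝ) ^ m)⁻¹ := by positivity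
  have h1 : Real.exp (cs * ((L : ℝ) ^ m)⁻¹) - 1 ≤ 2 * (cs * ((L : ℝ) ^ m)⁻¹) := by
    have h := Real.abs_exp_sub_one_le (x := cs * ((L : ℝ) ^ m)⁻¹) (by rwa [abs_of_nonneg hx0])
    rw [abs_of_nonneg hx0] at h
    exact (le_abs_self _).trans h
  have h2 : ((L : ℝ)⁻¹) ^ (m + 1) * (2 * L * cs) = 2 * (cs * ((L : ℝ) ^ m)⁻¹) := by
    rw [pow_succ, inv_pow]; field_simp
  rw [h2]; exact h1

end Summit.QuantumFields.YangMills.Theorems.HalvingP1FlatCoreSupplierAssembly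

end
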